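import Summits.AtomisticToContinuum.BoseEinsteinCondensation.Theses.BECFisherTransfer
import Literature.MathematicalPhysics.QuantumManyBody.PeriodicBoseGasFracEnergy
import Literature.MathematicalPhysics.QuantumManyBody.BoseGasThermodynamicLimitRuelle
import HarnessLib

/-!
# Crux `CoherencePropagation` (stmt-AtomisticToContinuum-14303) — strategist r1 (REDIRECT):
# costume certificate + the best typed split, kernel-checked (NOT filed; see `STRATEGY-CENSUS.md`)

Route `route-AtomisticToContinuum-BECFisherTransfer`, deciding theorem
`closes : HealingScaleCoherence → CoherencePropagation → BoundaryTransferWeak → BoseEinsteinCondensation`.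

## Part 1 — the crux is torus BEC with `c = 1/2` in costume

* `PeriodicBecHalf` — the route's target `PeriodicBec` (item 8997, summit-strength by placement:
  censuses `Cruxes/PeriodicBEC/STRATEGY-CENSUS{,-r1}.md`) with the constant FIXED at `c = 1/2`.
* `coherencePropagation_of_periodicBecHalf : PeriodicBecHalf → CoherencePropagation` (drop the
  near-field hypothesis).
* `periodicBecHalf_of_coherence : HealingScaleCoherence → CoherencePropagation → PeriodicBecHalf`
  (the logic of `closes`, stopped before `BoundaryTransferWeak`).
* `coherencePropagation_iff_periodicBecHalf : HealingScaleCoherence → (CoherencePropagation ↔ PeriodicBecHalf)`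
  — modulo the route's OWN rank-3 in-class crux, the rank-2 crux IS torus BEC(½).
* `periodicBec_of_periodicBecHalf : PeriodicBecHalf → PeriodicBec`.
* `coherencePropagationAt_mono` — the crux at exponent `σ` implies it at every `σ' ≥ σ`: all content
  sits at `σ → 0⁺` (coherence assumed only just beyond the healing length).

## Part 2 — the best typed split (D-A): Fourier side of the hypothesis + deep-infrared window

* `LowBandOfNearField` (support, provable now, M): near-field coherence `G ≥ 3/4` on `|r| ≤ R` puts
  `≥ (3/4 - ε)N` particles in the plane waves with `|k|R ≤ K(ε)` (termwise ball average of the momentum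
  representation `N·G(i,y) = ∑_p n_p cos(k_p·y)`; ball multiplier `ω(t) = 3(sin t - t cos t)/t³`,
  `|ω(t)| ≤ 3(1+t)/t³`). Tools landed: `Theorems.setIntegral_conj_translate_mul_eq_tsum`,
  `Theorems.integral_ball_cos_inner`, `Theorems.re_setAverage_ball_cellWave_le` (sibling route
  BECSubharmonicContinuation, items 9001/9002 proved).
* `DeepWindowBound` (the open piece): near-minimisers put `≤ wN`, `w < 1/4`, into the DEEP-INFRARED
  window `0 < |k| ≤ K/R_σ`, `R_σ = a(ρa³)^{-1/2-σ}` (momenta parametrically BELOW the healing momentum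
  `√(ρa)` by the factor `K(ρa³)^σ`), for every `K`, at all small densities.
* `condensate_ge_of_bandBounds` + `CoherencePropagation_of_subs :
  LowBandOfNearField → DeepWindowBound → CoherencePropagation` — PROVED (mode bookkeeping `tr γ = N`,
  `n_0 = condensateOccupation`; `ε := 1/4 - w`).

## Part 3 — placement of the open piece

* `deepWindowBound_of_strongBec : StrongBec → DeepWindowBound`: ANY torus-BEC statement for
  near-minimisers with a constant above `3/4` (uniform in `N`) gives the open piece — it is a
  no-infrared-catastrophe statement of the `stub_irShell` / `DeepIRCube` / `PeriodicIRBound` family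
  (`Cruxes/PeriodicBEC/Lines/birth.lean`, `Cruxes/PeriodicBEC/StrategistSplitR1.lean`, item 3972),
  on which no registered line and no tool exists (`Literature.Barriers.AtomisticToContinuum.KineticGapLengthScalesNarrow`).

No `sorry` in this file.
-/

noncomputable section

open MeasureTheory Filter
open scoped ENNReal NNReal BigOperators ComplexConjugate Classical

namespace Summit.AtomisticToContinuum.BoseEinsteinCondensation.Cruxes.CoherencePropagation.StrategistR1

open Literature.MathematicalPhysics.QuantumManyBody.BoseGas
open Summit.AtomisticToContinuum.BoseEinsteinCondensation.Theses.BECFisherTransfer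

/-! ## Part 1 — costume certificate -/

/-- **Torus BEC with the constant fixed at one half**: the route target `PeriodicBec` (item 8997)
with `c = 1/2` (hence `c` trivially uniform in `ρ`). -/
def PeriodicBecHalf : Prop :=
  ∀ v : ℝ → ℝ≥0∞, IsRepulsiveFiniteRange v → ∃ ρ₀ : ℝ, 0 < ρ₀ ∧ ∀ ρ : ℝ, 0 < ρ → ρ < ρ₀ →
    ∀ᶠ N : ℕ in atTop, ∃ δ : ℝ≥0∞, 0 < δ ∧ ∀ Ψ : PeriodicTrialState N (sideLength ρ N),
      periodicEnergy v Ψ ≤ periodicGroundStateEnergy v N (sideLength ρ N) + δ →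
        ENNReal.ofReal ((1 / 2 : ℝ) * N) ≤ condensateOccupation N (sideLength ρ N) Ψ.ψ

/-- `PeriodicBecHalf → CoherencePropagation`: discard `σ` and the near-field hypothesis. -/
theorem coherencePropagation_of_periodicBecHalf : PeriodicBecHalf → CoherencePropagation := by
  intro h v hv σ _hσ
  obtain ⟨ρ₀, hρ₀, hρ⟩ := h v hv
  refine ⟨ρ₀, hρ₀, fun ρ hρpos hρlt => ?_⟩
  filter_upwards [hρ ρ hρpos hρlt] with N hN
  obtain ⟨δ, hδ, hΨ⟩ := hN
  exact ⟨δ, hδ, fun Ψ hE _ => hΨ Ψ hE⟩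

/-- `HealingScaleCoherence → CoherencePropagation → PeriodicBecHalf`: the bookkeeping of `closes`
(fix `v`; `σ, ρ₂, δ₂` from the local crux; `ρ₁, δ₁` from propagation at that `σ`; minima). -/
theorem periodicBecHalf_of_coherence :
    HealingScaleCoherence → CoherencePropagation → PeriodicBecHalf := by
  intro hLoc hProp v hv
  obtain ⟨σ, hσ, ρ₂, hρ₂, hA'⟩ := hLoc v hv
  obtain ⟨ρ₁, hρ₁, hP'⟩ := hProp v hv σ hσ
  refine ⟨min ρ₁ ρ₂, lt_min hρ₁ hρ₂, fun ρ hρ hρlt => ?_⟩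
  have h₁ := hP' ρ hρ (lt_of_lt_of_le hρlt (min_le_left _ _))
  have h₂ := hA' ρ hρ (lt_of_lt_of_le hρlt (min_le_right _ _))
  filter_upwards [h₁, h₂] with N hN₁ hN₂
  obtain ⟨δ₁, hδ₁, H₁⟩ := hN₁
  obtain ⟨δ₂, hδ₂, H₂⟩ := hN₂
  refine ⟨min δ₁ δ₂, lt_min hδ₁ hδ₂, fun Ψ hΨ => ?_⟩
  exact H₁ Ψ (hΨ.trans <| by gcongr; exact min_le_left _ _)
    (H₂ Ψ (hΨ.trans <| by gcongr; exact min_le_right _ _))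

/-- **The costume theorem.** Given the route's own rank-3 crux `HealingScaleCoherence` (graded
in-class / L by the route itself), the rank-2 crux `CoherencePropagation` is EQUIVALENT to torus BEC
of near-minimisers with `c = 1/2`, i.e. to the target `PeriodicBec` with its constant pinned. -/
theorem coherencePropagation_iff_periodicBecHalf (hLoc : HealingScaleCoherence) :
    CoherencePropagation ↔ PeriodicBecHalf :=
  ⟨periodicBecHalf_of_coherence hLoc, coherencePropagation_of_periodicBecHalf⟩

/-- `PeriodicBecHalf → PeriodicBec` (item 8997, `c := 1/2`). -/
theorem periodicBec_of_periodicBecHalf : PeriodicBecHalf → PeriodicBec := by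
  intro h v hv
  obtain ⟨ρ₀, hρ₀, hρ⟩ := h v hv
  exact ⟨ρ₀, hρ₀, fun ρ hρpos hρlt => ⟨1 / 2, by norm_num, hρ ρ hρpos hρlt⟩⟩

/-- Hence, given `HealingScaleCoherence`, the crux gives the target (this is item 14101
`PeriodicBecOfCoherence`, landed as `Theorems/BECFisherTransferPeriodicBecOfCoherence.lean`). -/
theorem periodicBec_of_coherence : HealingScaleCoherence → CoherencePropagation → PeriodicBec :=
  fun hLoc hProp => periodicBec_of_periodicBecHalf (periodicBecHalf_of_coherence hLoc hProp)

/-- The crux at a FIXED exponent `σ` (coherence assumed out to `R_σ = a(ρa³)^{-1/2-σ}`). -/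
def CoherencePropagationAt (σ : ℝ) : Prop :=
  ∀ v : ℝ → ℝ≥0∞, IsRepulsiveFiniteRange v → ∃ ρ₀ : ℝ, 0 < ρ₀ ∧ ∀ ρ : ℝ, 0 < ρ → ρ < ρ₀ →
    ∀ᶠ N : ℕ in atTop, ∃ δ : ℝ≥0∞, 0 < δ ∧ ∀ Ψ : PeriodicTrialState N (sideLength ρ N),
      periodicEnergy v Ψ ≤ periodicGroundStateEnergy v N (sideLength ρ N) + δ →
        (∀ (i : Fin N) (r : EuclideanSpace ℝ (Fin 3)),
          ‖r‖ ≤ (scatteringLength v).toReal * (ρ * (scatteringLength v).toReal ^ 3) ^ (-(1 : ℝ) / 2 - σ) →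
            (3 / 4 : ℝ) ≤ (∫ X in cellN N (sideLength ρ N),
              conj (Ψ.ψ (Function.update X i (X i + r))) * Ψ.ψ X).re) →
          ENNReal.ofReal ((1 / 2 : ℝ) * N) ≤ condensateOccupation N (sideLength ρ N) Ψ.ψ

/-- The crux is the conjunction over `σ > 0` of its fixed-exponent instances (quantifier swap). -/
theorem coherencePropagation_iff_forall_at :
    CoherencePropagation ↔ ∀ σ : ℝ, 0 < σ → CoherencePropagationAt σ :=
  ⟨fun h σ hσ v hv => h v hv σ hσ, fun h v hv σ hσ => h σ hσ v hv⟩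

/-- **Monotonicity in the exponent**: the instance at `σ` implies the instance at every `σ' ≥ σ`
(at `ρa³ ≤ 1` the radius `R_σ = a(ρa³)^{-1/2-σ}` is non-decreasing in `σ`, so the hypothesis at `σ'`
is stronger). All difficulty of the crux is at `σ → 0⁺`. -/
theorem coherencePropagationAt_mono {σ σ' : ℝ} (hσ : 0 < σ) (hσσ' : σ ≤ σ') :
    CoherencePropagationAt σ → CoherencePropagationAt σ' := by
  intro h v hv
  obtain ⟨ρ₀, hρ₀, hρ⟩ := h v hv
  set a : ℝ := (scatteringLength v).toReal with ha
  have ha0 : 0 ≤ a := ENNReal.toReal_nonneg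
  have hm : 0 < max 1 (a ^ 3) := lt_of_lt_of_le one_pos (le_max_left _ _)
  refine ⟨min ρ₀ (1 / max 1 (a ^ 3)), lt_min hρ₀ (by positivity), fun ρ hρpos hρlt => ?_⟩
  have hρ0 : ρ < ρ₀ := hρlt.trans_le (min_le_left _ _)
  have hx1 : ρ * a ^ 3 ≤ 1 := by
    have h1 : ρ < 1 / max 1 (a ^ 3) := hρlt.trans_le (min_le_right _ _)
    rw [lt_div_iff₀ hm] at h1
    have : ρ * a ^ 3 ≤ ρ * max 1 (a ^ 3) := mul_le_mul_of_nonneg_left (le_max_right _ _) hρpos.le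
    linarith
  have hx0 : 0 ≤ ρ * a ^ 3 := by positivity
  have hR : a * (ρ * a ^ 3) ^ (-(1 : ℝ) / 2 - σ) ≤ a * (ρ * a ^ 3) ^ (-(1 : ℝ) / 2 - σ') := by
    refine mul_le_mul_of_nonneg_left ?_ ha0
    rcases hx0.eq_or_lt with hx | hx
    · rw [← hx, Real.zero_rpow (by linarith : -(1 : ℝ) / 2 - σ < 0).ne,
        Real.zero_rpow (by linarith : -(1 : ℝ) / 2 - σ' < 0).ne]
    · exact Real.rpow_le_rpow_of_exponent_ge hx hx1 (by linarith)
  filter_upwards [hρ ρ hρpos hρ0] with N hN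
  obtain ⟨δ, hδ, hΨ⟩ := hN
  exact ⟨δ, hδ, fun Ψ hE hcoh => hΨ Ψ hE fun i r hr => hcoh i r (hr.trans hR)⟩

/-! ## Part 2 — the best typed split (D-A), glue proved -/

/-- **LowBandOfNearField** (support, provable now, M — the Fourier side of the crux's hypothesis):
for every `ε > 0` there is `K > 0` such that on any torus of side `L > 0`, for any periodic trial
state `Ψ`, particle `i` and radius `R ≥ 0`: if `Re G_Ψ(i,r) ≥ 3/4` for all `|r| ≤ R`, then the plane
waves with `|k| R ≤ K` (`|k|² = fracDispersion 2 L p`) carry at least `(3/4 - ε)N` particles.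
(At `R = 0` the band is all of `ℤ³` and the claim is `tr γ = N ≥ (3/4-ε)N`.) -/
def LowBandOfNearField : Prop :=
  ∀ ε : ℝ, 0 < ε → ∃ K : ℝ, 0 < K ∧ ∀ (N : ℕ) (L : ℝ), 0 < L →
    ∀ (Ψ : PeriodicTrialState N L) (i : Fin N) (R : ℝ), 0 ≤ R →
      (∀ r : EuclideanSpace ℝ (Fin 3), ‖r‖ ≤ R →
        (3 / 4 : ℝ) ≤ (∫ X in cellN N L, conj (Ψ.ψ (Function.update X i (X i + r))) * Ψ.ψ X).re) →
      ENNReal.ofReal ((3 / 4 - ε) * N) ≤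
        ∑' p : Fin 3 → ℤ, if fracDispersion 2 L p * ENNReal.ofReal (R ^ 2) ≤ ENNReal.ofReal (K ^ 2) then
          cellOccupation N L (planeWaveMode L p) Ψ.ψ else 0

/-- **DeepWindowBound** (the open piece — no infrared catastrophe in the DEEP-infrared window):
for every repulsive finite-range `v` and `σ > 0` there is a fraction `w ∈ [0, 1/4)` such that for
every `K > 0` there is `ρ₀ > 0` with: for `0 < ρ < ρ₀`, for all large `N`, for some slack `δ > 0`,
every `δ`-near-minimiser on the torus of side `(N/ρ)^{1/3}` has total occupation at most `wN` in the
window `p ≠ 0`, `|k| R_σ ≤ K`, where `R_σ = a(ρa³)^{-1/2-σ}` (`a` the scattering length).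
(For `a = 0` the window is all of `ℤ³ ∖ {0}`: torus BEC `≥ (1-w)N` of the `a = 0` gas.) -/
def DeepWindowBound : Prop :=
  ∀ v : ℝ → ℝ≥0∞, IsRepulsiveFiniteRange v → ∀ σ : ℝ, 0 < σ →
    ∃ w : ℝ, 0 ≤ w ∧ w < 1 / 4 ∧ ∀ K : ℝ, 0 < K → ∃ ρ₀ : ℝ, 0 < ρ₀ ∧ ∀ ρ : ℝ, 0 < ρ → ρ < ρ₀ →
      ∀ᶠ N : ℕ in atTop, ∃ δ : ℝ≥0∞, 0 < δ ∧ ∀ Ψ : PeriodicTrialState N (sideLength ρ N),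
        periodicEnergy v Ψ ≤ periodicGroundStateEnergy v N (sideLength ρ N) + δ →
          (∑' p : Fin 3 → ℤ,
              if p ≠ 0 ∧ fracDispersion 2 (sideLength ρ N) p *
                  ENNReal.ofReal (((scatteringLength v).toReal *
                    (ρ * (scatteringLength v).toReal ^ 3) ^ (-(1 : ℝ) / 2 - σ)) ^ 2) ≤
                  ENNReal.ofReal (K ^ 2) then
                cellOccupation N (sideLength ρ N) (planeWaveMode (sideLength ρ N) p) Ψ.ψ
              else 0) ≤ ENNReal.ofReal (w * N)

/-- **Mode bookkeeping**: if a band `B ∋ 0` of plane waves carries `≥ θN` and its non-zero part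
`≤ wN`, then the zero mode carries `≥ (θ - w)N`. [cite: LSSY2005, §1.2 (1.18)] -/
theorem condensate_ge_of_bandBounds {N : ℕ} {L : ℝ} (Ψ : PeriodicTrialState N L)
    (B : (Fin 3 → ℤ) → Prop) [DecidablePred B] (hB0 : B 0) {θ w : ℝ} (hw : 0 ≤ w) (hwθ : w ≤ θ)
    (hLow : ENNReal.ofReal (θ * N) ≤
      ∑' p : Fin 3 → ℤ, if B p then cellOccupation N L (planeWaveMode L p) Ψ.ψ else 0)
    (hWin : (∑' p : Fin 3 → ℤ, if p ≠ 0 ∧ B p then cellOccupation N L (planeWaveMode L p) Ψ.ψ else 0) ≤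
      ENNReal.ofReal (w * N)) :
    ENNReal.ofReal ((θ - w) * N) ≤ condensateOccupation N L Ψ.ψ := by
  have hpt : ∀ p : Fin 3 → ℤ, (if B p then cellOccupation N L (planeWaveMode L p) Ψ.ψ else 0) =
      (if p = 0 then cellOccupation N L (planeWaveMode L p) Ψ.ψ else 0) +
        (if p ≠ 0 ∧ B p then cellOccupation N L (planeWaveMode L p) Ψ.ψ else 0) := by
    intro p
    by_cases hp : p = 0
    · subst hp
      rw [if_pos hB0, if_pos rfl, if_neg (fun h => h.1 rfl), add_zero]
    · by_cases hb : B p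
      · rw [if_pos hb, if_neg hp, if_pos ⟨hp, hb⟩, zero_add]
      · rw [if_neg hb, if_neg hp, if_neg (fun h => hb h.2), zero_add]
  have hzero : (∑' p : Fin 3 → ℤ, if p = 0 then cellOccupation N L (planeWaveMode L p) Ψ.ψ else 0) =
      condensateOccupation N L Ψ.ψ := by
    rw [tsum_eq_single (0 : Fin 3 → ℤ) (fun p hp => if_neg hp), if_pos rfl,
      cellOccupation_planeWaveMode_zero]
  have hmain : ENNReal.ofReal (θ * N) ≤ condensateOccupation N L Ψ.ψ + ENNReal.ofReal (w * N) := by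
    calc ENNReal.ofReal (θ * N)
        ≤ ∑' p : Fin 3 → ℤ, if B p then cellOccupation N L (planeWaveMode L p) Ψ.ψ else 0 := hLow
      _ = (∑' p : Fin 3 → ℤ, if p = 0 then cellOccupation N L (planeWaveMode L p) Ψ.ψ else 0) +
            ∑' p : Fin 3 → ℤ, if p ≠ 0 ∧ B p then cellOccupation N L (planeWaveMode L p) Ψ.ψ else 0 := by
          rw [tsum_congr hpt, ENNReal.tsum_add]
      _ ≤ condensateOccupation N L Ψ.ψ + ENNReal.ofReal (w * N) := by
          rw [hzero]; exact add_le_add le_rfl hWin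
  have hsplit : ENNReal.ofReal (θ * N) = ENNReal.ofReal ((θ - w) * N) + ENNReal.ofReal (w * N) := by
    rw [← ENNReal.ofReal_add (mul_nonneg (by linarith) N.cast_nonneg) (mul_nonneg hw N.cast_nonneg)]
    congr 1; ring
  rw [hsplit] at hmain
  exact ENNReal.le_of_add_le_add_right ENNReal.ofReal_ne_top hmain

/-- **Split D-A, glue PROVED**: `LowBandOfNearField → DeepWindowBound → CoherencePropagation`
(the route decl, BY NAME). Fix `v, σ`; `w < 1/4` from the window piece, `ε := 1/4 - w`, `K := K(ε)`
from the low-band piece, `ρ₀ := ρ₀(K)`; eventually in `N` (and `N > 0`, so `L > 0`) the near-field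
hypothesis of the crux feeds the low-band piece at `R := R_σ`, and `(3/4 - ε) - w = 1/2`. -/
theorem CoherencePropagation_of_subs :
    LowBandOfNearField → DeepWindowBound → CoherencePropagation := by
  intro hLow hWin v hv σ hσ
  obtain ⟨w, hw0, hw4, hWinK⟩ := hWin v hv σ hσ
  obtain ⟨K, hK, hLowK⟩ := hLow (1 / 4 - w) (by linarith)
  obtain ⟨ρ₀, hρ₀, hWinρ⟩ := hWinK K hK
  refine ⟨ρ₀, hρ₀, fun ρ hρ hρlt => ?_⟩
  filter_upwards [hWinρ ρ hρ hρlt, Filter.eventually_gt_atTop 0] with N hN hNpos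
  obtain ⟨δ, hδ, hΨN⟩ := hN
  refine ⟨δ, hδ, fun Ψ hΨ hcoh => ?_⟩
  have hL : 0 < sideLength ρ N := Real.rpow_pos_of_pos (div_pos (Nat.cast_pos.mpr hNpos) hρ) _
  have hR0 : 0 ≤ (scatteringLength v).toReal *
      (ρ * (scatteringLength v).toReal ^ 3) ^ (-(1 : ℝ) / 2 - σ) :=
    mul_nonneg ENNReal.toReal_nonneg (Real.rpow_nonneg (by positivity) _)
  have hB0 : fracDispersion 2 (sideLength ρ N) 0 *
      ENNReal.ofReal (((scatteringLength v).toReal *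
        (ρ * (scatteringLength v).toReal ^ 3) ^ (-(1 : ℝ) / 2 - σ)) ^ 2) ≤ ENNReal.ofReal (K ^ 2) := by
    rw [fracDispersion_zero two_ne_zero, zero_mul]; exact zero_le
  have h1 := hLowK N (sideLength ρ N) hL Ψ ⟨0, hNpos⟩ _ hR0 (hcoh ⟨0, hNpos⟩)
  have h2 := hΨN Ψ hΨ
  have h := condensate_ge_of_bandBounds Ψ
    (fun p => fracDispersion 2 (sideLength ρ N) p *
      ENNReal.ofReal (((scatteringLength v).toReal *
        (ρ * (scatteringLength v).toReal ^ 3) ^ (-(1 : ℝ) / 2 - σ)) ^ 2) ≤ ENNReal.ofReal (K ^ 2))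
    hB0 hw0 (by linarith : w ≤ 3 / 4 - (1 / 4 - w)) h1 h2
  have h34 : (3 / 4 - (1 / 4 - w) - w : ℝ) = 1 / 2 := by ring
  rw [h34] at h
  exact h

/-! ## Part 3 — placement of the open piece -/

/-- **StrongBec**: torus BEC of near-minimisers with some constant ABOVE `3/4`, uniform in `N`
(for each `v`: `∃ η ∈ (0, 1/4]`, `n_0 ≥ (3/4 + η)N`). A `PeriodicBec`-type statement (item 8997 with
a pinned large constant); implied by `PeriodicIRBound`-type infrared bounds (item 3972, refuted ×0,
dead ×14 seats) through the birth bookkeeping. -/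
def StrongBec : Prop :=
  ∀ v : ℝ → ℝ≥0∞, IsRepulsiveFiniteRange v → ∃ η : ℝ, 0 < η ∧ η ≤ 1 / 4 ∧ ∃ ρ₀ : ℝ, 0 < ρ₀ ∧
    ∀ ρ : ℝ, 0 < ρ → ρ < ρ₀ → ∀ᶠ N : ℕ in atTop, ∃ δ : ℝ≥0∞, 0 < δ ∧
      ∀ Ψ : PeriodicTrialState N (sideLength ρ N),
        periodicEnergy v Ψ ≤ periodicGroundStateEnergy v N (sideLength ρ N) + δ →
          ENNReal.ofReal ((3 / 4 + η) * N) ≤ condensateOccupation N (sideLength ρ N) Ψ.ψ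

/-- **Any band off the zero mode is bounded by the depletion**: if `n_0 ≥ θ'N` then every sub-sum
of `∑_{p ≠ 0} n_p` is `≤ (1 - θ')N`. [cite: LSSY2005, §1.2 (1.18)] -/
theorem offZero_band_le_of_condensate_ge {N : ℕ} {L : ℝ} (hL : 0 < L) (Ψ : PeriodicTrialState N L)
    (B : (Fin 3 → ℤ) → Prop) [DecidablePred B] {θ' : ℝ} (hθ'0 : 0 ≤ θ') (hθ'1 : θ' ≤ 1)
    (h0 : ENNReal.ofReal (θ' * N) ≤ condensateOccupation N L Ψ.ψ) :
    (∑' p : Fin 3 → ℤ, if p ≠ 0 ∧ B p then cellOccupation N L (planeWaveMode L p) Ψ.ψ else 0) ≤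
      ENNReal.ofReal ((1 - θ') * N) := by
  -- `N = n_0 + ∑_{p ≠ 0} n_p`
  have hP : ∑' p : Fin 3 → ℤ, cellOccupation N L (planeWaveMode L p) Ψ.ψ = N :=
    Ψ.tsum_cellOccupation_planeWaveMode hL
  have hpt : ∀ p : Fin 3 → ℤ, cellOccupation N L (planeWaveMode L p) Ψ.ψ =
      (if p = 0 then cellOccupation N L (planeWaveMode L p) Ψ.ψ else 0) +
        (if p ≠ 0 then cellOccupation N L (planeWaveMode L p) Ψ.ψ else 0) := by
    intro p
    by_cases hp : p = 0
    · rw [if_pos hp, if_neg (fun h => h hp), add_zero]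
    · rw [if_neg hp, if_pos hp, zero_add]
  have hzero : (∑' p : Fin 3 → ℤ, if p = 0 then cellOccupation N L (planeWaveMode L p) Ψ.ψ else 0) =
      condensateOccupation N L Ψ.ψ := by
    rw [tsum_eq_single (0 : Fin 3 → ℤ) (fun p hp => if_neg hp), if_pos rfl,
      cellOccupation_planeWaveMode_zero]
  have hsum : (N : ℝ≥0∞) = condensateOccupation N L Ψ.ψ +
      ∑' p : Fin 3 → ℤ, if p ≠ 0 then cellOccupation N L (planeWaveMode L p) Ψ.ψ else 0 := by
    rw [← hzero, ← ENNReal.tsum_add, ← tsum_congr hpt, hP]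
  -- the band is a sub-sum of the off-zero sum
  have hsub : (∑' p : Fin 3 → ℤ, if p ≠ 0 ∧ B p then cellOccupation N L (planeWaveMode L p) Ψ.ψ else 0) ≤
      ∑' p : Fin 3 → ℤ, if p ≠ 0 then cellOccupation N L (planeWaveMode L p) Ψ.ψ else 0 := by
    refine ENNReal.tsum_le_tsum fun p => ?_
    by_cases hp : p ≠ 0 ∧ B p
    · rw [if_pos hp, if_pos hp.1]
    · rw [if_neg hp]; exact zero_le
  refine hsub.trans ?_
  -- cancel `n_0 ≥ θ'N` against `N = θ'N + (1-θ')N`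
  have hN : (N : ℝ≥0∞) = ENNReal.ofReal (θ' * N) + ENNReal.ofReal ((1 - θ') * N) := by
    rw [← ENNReal.ofReal_add (mul_nonneg hθ'0 N.cast_nonneg) (mul_nonneg (by linarith) N.cast_nonneg),
      ← add_mul]
    have h1 : θ' + (1 - θ') = 1 := by ring
    rw [h1, one_mul, ENNReal.ofReal_natCast]
  have hmain : ENNReal.ofReal (θ' * N) +
      (∑' p : Fin 3 → ℤ, if p ≠ 0 then cellOccupation N L (planeWaveMode L p) Ψ.ψ else 0) ≤
        ENNReal.ofReal (θ' * N) + ENNReal.ofReal ((1 - θ') * N) := by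
    calc ENNReal.ofReal (θ' * N) +
          (∑' p : Fin 3 → ℤ, if p ≠ 0 then cellOccupation N L (planeWaveMode L p) Ψ.ψ else 0)
        ≤ condensateOccupation N L Ψ.ψ +
          ∑' p : Fin 3 → ℤ, if p ≠ 0 then cellOccupation N L (planeWaveMode L p) Ψ.ψ else 0 :=
          add_le_add h0 le_rfl
      _ = N := hsum.symm
      _ = _ := hN
  exact ENNReal.le_of_add_le_add_left ENNReal.ofReal_ne_top hmain

/-- **Placement**: a torus-BEC statement with any constant above `3/4` already gives the open piece
(`w := 1/4 - η`, any window). So `DeepWindowBound` is a member of the infrared family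
{`stub_irShell`, `DeepIRCube`, `PeriodicIRBound`, `PeriodicBec` with pinned constant}: weaker than
each as typed, and closed by no registered line or tool. -/
theorem deepWindowBound_of_strongBec : StrongBec → DeepWindowBound := by
  intro h v hv σ _hσ
  obtain ⟨η, hη, hη4, ρ₀, hρ₀, hρ⟩ := h v hv
  refine ⟨1 / 4 - η, by linarith, by linarith, fun K _hK => ⟨ρ₀, hρ₀, fun ρ hρpos hρlt => ?_⟩⟩
  filter_upwards [hρ ρ hρpos hρlt, Filter.eventually_gt_atTop 0] with N hN hNpos
  obtain ⟨δ, hδ, hΨ⟩ := hN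
  refine ⟨δ, hδ, fun Ψ hE => ?_⟩
  have hL : 0 < sideLength ρ N := Real.rpow_pos_of_pos (div_pos (Nat.cast_pos.mpr hNpos) hρpos) _
  have h := offZero_band_le_of_condensate_ge hL Ψ
    (fun p => fracDispersion 2 (sideLength ρ N) p *
      ENNReal.ofReal (((scatteringLength v).toReal *
        (ρ * (scatteringLength v).toReal ^ 3) ^ (-(1 : ℝ) / 2 - σ)) ^ 2) ≤ ENNReal.ofReal (K ^ 2))
    (by linarith : 0 ≤ 3 / 4 + η) (by linarith : 3 / 4 + η ≤ 1) (hΨ Ψ hE)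
  have h14 : (1 - (3 / 4 + η) : ℝ) = 1 / 4 - η := by ring
  rw [h14] at h
  exact h

/-! ## Audit: the glue theorems conclude the crux BY NAME and use no `sorry` -/

#print axioms coherencePropagation_iff_periodicBecHalf
#print axioms CoherencePropagation_of_subs
#print axioms deepWindowBound_of_strongBec
#print axioms coherencePropagationAt_mono

end Summit.AtomisticToContinuum.BoseEinsteinCondensation.Cruxes.CoherencePropagation.StrategistR1
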